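/-
Copyright: internal research formalization. Sources: P. Keevash, N. Lifshitz, *Sharp hypercontractivity for
symmetric groups and its applications*, arXiv:2307.15030 [KeevashLifshitz2023], Def. 1.4 (p. 11 of the held
text `paper:arxiv-2307.15030`, chunk p0011) and Theorem 3.1 (§3, chunk p0017); N. Keller, N. Lifshitz,
O. Marcus, *Sharp hypercontractivity for global functions*, arXiv:2307.01356 = J. Eur. Math. Soc. (2026)
[KellerLifshitzMarcus2023], Proposition 5.5 (p. 48 of the held text `paper:arxiv-2307.01356`: the
`L¹`-only globalness hypothesis "`E[f_{S→x}] ≤ r^{|S|} γ`" for bounded functions).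
-/
import Literature.Combinatorics.Additive.LevelDInequalitySn
import HarnessLib

/-!
# The level-`d` inequality for BOUNDED `L¹`-global functions on `S_n` (Keevash–Lifshitz Thm 3.1, read for `|f| ≤ G`) — PROVED

Keevash–Lifshitz, arXiv:2307.15030, p. 5: *"A more refined version (see Theorem 3.1 below), which applies to
'biglobal' general functions (not just sets), will be the key tool from Analysis underpinning the
applications"*; Def. 1.4 (p. 11): *"We say that `f` is `(r, γ₁, γ₂, d)`-biglobal if `‖f_*‖₁ ≤ r^t γ₁` and
`‖f_*‖₂ ≤ r^t γ₂` for all `t`-restrictions `f_*` of `f` with `t ≤ d`"*; **Theorem 3.1** (p. 17): *"Let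
`f ∈ L²(S_n)` be `(r, γ₁, γ₂, d)`-biglobal with `r > 1`, `γ₂ > γ₁ > 0` and `d ≤ min(¼ log(γ₂/γ₁), 10⁻⁵ n)`.
Then `‖f^{=d}‖₂² ≤ γ₁² (10⁶ r² d⁻¹ log(γ₂/γ₁))^d`."* — the tree's `GlobalLevelDInequalityBiglobal`,
PROVED in the tree as `GlobalLevelDInequalityBiglobal_holds` (`LevelDInequalitySn.lean`, through the proved
Keller–Lifshitz–Marcus Theorem 5.4 on `[n]^n`).

"Biglobal" means BOTH restriction norms are controlled (`L¹` and `L²`), not "global in two factors". For a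
BOUNDED function only the `L¹` condition has to be checked — this is how Keller–Lifshitz–Marcus use their
Theorem 5.4 for `{0,1}`-valued `f` (Prop. 5.5, p. 48: hypothesis *"`E[f_{S→x}] ≤ r^{|S|} γ` for all sets `S`
of size `≤ d` and for all `x ∈ Ω^S`"*, then "by Lemma 4.9, `f` is `(2r, √γ, d)`-`L²`-global and
`(2r, γ, d)`-`L¹`-global"), and how the tree's `isBiglobal_indicator_mul` treats `y·1_A` with `|y| ≤ 1`.
This file records the general bounded case, which is the form the cell's matching side asks for (prover
MEMO-37 §5: *"`‖f^{=d}‖₂² ≤ ‖f‖₁²·(C r⁴ log(1/‖f‖₁)/d)^d` … for `f : S_n → [0,1]` `r`-(bi)global — yes/no,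
locator, constants"*): YES, with `C r⁴` replaced by `5·10⁵ r²` in the FUNCTION normalisation of
globalness (`E_U |f| ≤ r^t γ`; the set convention `μ_U(A) ≤ r^{2t} μ(A)` of Def. 1.6 is the case `r ↦ r²`),
for `d ≤ min(⅛ log(G/γ), 10⁻⁵ n)`:

* `IsL1GlobalSn r γ d f` — the `L¹` half of Def. 1.4 / the hypothesis of KLM Prop. 5.5 on `S_n`:
  `Σ_{σ ∈ U_{I→J}} |f σ| ≤ r^t γ |U_{I→J}|` for all injective `t`-tuples `I, J`, `t ≤ d`;
* `isBiglobal_of_isL1GlobalSn` — if `|f| ≤ G` and `f` is `(r, γ, d)`-`L¹`-global with `r ≥ 1` then `f` is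
  `(r, γ, √(Gγ), d)`-biglobal (`E_U f² ≤ G·E_U|f| ≤ G r^t γ ≤ (r^t)² Gγ`);
* **`levelPart_sq_le_of_isL1GlobalSn`** — for `|f| ≤ G`, `(r, γ, d)`-`L¹`-global, `r > 1`, `0 < γ < G`,
  `d ≤ min(⅛ log(G/γ), 10⁻⁵ n)`: `‖f^{=d}‖₂² ≤ γ² (5·10⁵ · r² · d⁻¹ · log(G/γ))^d` (Theorem 3.1 with
  `γ₁ = γ`, `γ₂ = √(Gγ)`, `log(γ₂/γ₁) = ½ log(G/γ)`), UNCONDITIONAL;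
* `levelPart_sq_le_of_isL1GlobalSn_unit` — the case `G = 1` (`f : S_n → [−1, 1]`), the displayed formula;
* `isL1GlobalSn_dual` — the consumer ("dual") reading against a test vector `g ∈ V_{≤d} ⊖ V_{≤d−1}`:
  `(Σ_σ f σ g σ)² ≤ ‖g‖² · n! · γ² (5·10⁵ r² d⁻¹ log(G/γ))^d`.

No named facts (net debt 0); 0 sorries; standard axioms. WHAT THIS IS NOT: nothing on product domains
(slice × `S_n`) — Theorem 3.1 is a one-domain statement; no matchings, psd rank or P-vs-NP content.

## References
* [KeevashLifshitz2023] P. Keevash, N. Lifshitz, arXiv:2307.15030 — Def. 1.4 (p. 11), Thm. 3.1 (p. 17), p. 5.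
* [KellerLifshitzMarcus2023] N. Keller, N. Lifshitz, O. Marcus, arXiv:2307.01356 = JEMS 2026 — Prop. 5.5
  (p. 48), Thm. 5.4 (p. 48).
-/

noncomputable section

namespace Literature.Combinatorics.Additive.KeevashLifshitz

open Finset
open scoped InnerProductSpace

variable {n : ℕ}

/-! ## `L¹`-globalness of a function on `S_n` -/

/-- **`(r, γ, d)`-`L¹`-global function on `S_n`**: the `L¹` half of Keevash–Lifshitz's Def. 1.4
(`‖f_{I→J}‖₁ ≤ r^t γ` for all `t`-restrictions, `t ≤ d`), equivalently the hypothesis of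
Keller–Lifshitz–Marcus's Prop. 5.5 transported to `S_n` ("`E[f_{S→x}] ≤ r^{|S|} γ`"), with cleared
denominators: `Σ_{σ ∈ U_{I→J}} |f σ| ≤ r^t γ |U_{I→J}|` for injective `I, J : Fin t → Fin n`, `t ≤ d`.
[cite: KeevashLifshitz2023, Def. 1.4 (p. 11)] [cite: KellerLifshitzMarcus2023, Prop. 5.5 (p. 48, hypothesis)] -/
def IsL1GlobalSn (r γ : ℝ) (d : ℕ) (f : Equiv.Perm (Fin n) → ℝ) : Prop :=
  ∀ t : ℕ, t ≤ d → ∀ I J : Fin t → Fin n, Function.Injective I → Function.Injective J →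
    (∑ σ ∈ umvirate I J, |f σ|) ≤ r ^ t * γ * ((umvirate I J).card : ℝ)

/-- A biglobal function is in particular `L¹`-global (the first clause of Def. 1.4).
[cite: KeevashLifshitz2023, Def. 1.4 (p. 11)] -/
theorem IsBiglobal.isL1GlobalSn {r γ₁ γ₂ : ℝ} {d : ℕ} {f : Equiv.Perm (Fin n) → ℝ}
    (h : IsBiglobal r γ₁ γ₂ d f) : IsL1GlobalSn r γ₁ d f :=
  fun t ht I J hI hJ => (h t ht I J hI hJ).1

/-- **Bounded `L¹`-global functions are biglobal**: if `|f| ≤ G` and `f` is `(r, γ, d)`-`L¹`-global with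
`r ≥ 1`, then `f` is `(r, γ, √(Gγ), d)`-biglobal, since `E_U f² ≤ G · E_U |f| ≤ G r^t γ ≤ (r^t √(Gγ))²`
(Keller–Lifshitz–Marcus's remark for `{0,1}`-valued `f`: "`f` is `(2r, √γ, d)`-`L²`-global and
`(2r, γ, d)`-`L¹`-global"). [cite: KellerLifshitzMarcus2023, Prop. 5.5 (p. 48, proof, first lines)] [cite: KeevashLifshitz2023, Def. 1.4 (p. 11)] -/
theorem isBiglobal_of_isL1GlobalSn {r γ G : ℝ} {d : ℕ} {f : Equiv.Perm (Fin n) → ℝ} (hr : 1 ≤ r)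
    (hγ : 0 ≤ γ) (hG : 0 ≤ G) (hfG : ∀ σ, |f σ| ≤ G) (h : IsL1GlobalSn r γ d f) :
    IsBiglobal r γ (Real.sqrt (G * γ)) d f := by
  intro t ht I J hI hJ
  have hL1 := h t ht I J hI hJ
  refine ⟨hL1, ?_⟩
  set c : ℝ := ((umvirate I J).card : ℝ) with hc
  have hc0 : 0 ≤ c := by positivity
  have h1 : ∑ σ ∈ umvirate I J, f σ ^ 2 ≤ G * ∑ σ ∈ umvirate I J, |f σ| := by
    rw [Finset.mul_sum]
    refine Finset.sum_le_sum fun σ _ => ?_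
    calc f σ ^ 2 = |f σ| * |f σ| := by rw [← sq_abs, sq]
      _ ≤ G * |f σ| := mul_le_mul_of_nonneg_right (hfG σ) (abs_nonneg _)
  have h2 : G * ∑ σ ∈ umvirate I J, |f σ| ≤ G * (r ^ t * γ * c) := mul_le_mul_of_nonneg_left hL1 hG
  have h3 : r ^ t ≤ (r ^ t) ^ 2 := by
    have h1r : 1 ≤ r ^ t := one_le_pow₀ hr
    nlinarith
  have h4 : r ^ t * (G * γ * c) ≤ (r ^ t) ^ 2 * (G * γ * c) :=
    mul_le_mul_of_nonneg_right h3 (by positivity)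
  calc ∑ σ ∈ umvirate I J, f σ ^ 2 ≤ G * (r ^ t * γ * c) := h1.trans h2
    _ = r ^ t * (G * γ * c) := by ring
    _ ≤ (r ^ t) ^ 2 * (G * γ * c) := h4
    _ = (r ^ t * Real.sqrt (G * γ)) ^ 2 * c := by
        rw [mul_pow, Real.sq_sqrt (mul_nonneg hG hγ)]; ring

/-- `log(√(Gγ)/γ) = ½ log(G/γ)` (`γ > 0`, `G ≥ 0`). [folklore] -/
private theorem log_sqrt_mul_div {γ G : ℝ} (hγ : 0 < γ) (hG : 0 ≤ G) :
    Real.log (Real.sqrt (G * γ) / γ) = Real.log (G / γ) / 2 := by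
  have heq : Real.sqrt (G * γ) / γ = Real.sqrt (G / γ) := by
    rw [Real.sqrt_div' G hγ.le, Real.sqrt_mul hG γ,
      div_eq_div_iff hγ.ne' (Real.sqrt_pos.2 hγ).ne', mul_assoc, Real.mul_self_sqrt hγ.le]
  rw [heq, Real.log_sqrt (div_nonneg hG hγ.le)]

/-! ## The level-`d` inequality for bounded `L¹`-global functions -/

/-- **Keevash–Lifshitz Theorem 3.1 for bounded `L¹`-global functions on `S_n`** (PROVED, unconditional):
if `|f| ≤ G`, `f` is `(r, γ, d)`-`L¹`-global, `r > 1`, `0 < γ < G` and `d ≤ min(⅛ log(G/γ), 10⁻⁵ n)`, then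
`‖f^{=d}‖₂² ≤ γ² (5·10⁵ · r² · d⁻¹ · log(G/γ))^d` — Theorem 3.1 with `γ₁ = γ`, `γ₂ = √(Gγ)`
(`log(γ₂/γ₁) = ½ log(G/γ)`, so `¼ log(γ₂/γ₁) = ⅛ log(G/γ)` and `10⁶ · ½ = 5·10⁵`). Norms as in the tree's
Theorem 3.1 module: `‖f^{=d}‖₂² = ‖levelPart n d (vec f)‖²/n!`, `log = Real.log`, `d⁻¹ = 1/d`.
[cite: KeevashLifshitz2023, Thm. 3.1 (p. 17)] [cite: KellerLifshitzMarcus2023, Prop. 5.5 (p. 48)] -/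
theorem levelPart_sq_le_of_isL1GlobalSn (f : Equiv.Perm (Fin n) → ℝ) {r γ G : ℝ} {d : ℕ}
    (hr : 1 < r) (hγ : 0 < γ) (hγG : γ < G) (hfG : ∀ σ, |f σ| ≤ G) (hglob : IsL1GlobalSn r γ d f)
    (hd₁ : (d : ℝ) ≤ Real.log (G / γ) / 8) (hd₂ : (d : ℝ) ≤ (n : ℝ) / 10 ^ 5) :
    ‖levelPart n d (vec f)‖ ^ 2 / n.factorial ≤
      γ ^ 2 * (5 * 10 ^ 5 * r ^ 2 * (1 / (d : ℝ)) * Real.log (G / γ)) ^ d := by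
  have hG : 0 < G := hγ.trans hγG
  have hbig := isBiglobal_of_isL1GlobalSn hr.le hγ.le hG.le hfG hglob
  have hγ₂ : γ < Real.sqrt (G * γ) := (Real.lt_sqrt hγ.le).2 (by nlinarith)
  have hlog := log_sqrt_mul_div hγ hG.le
  have hd₁' : (d : ℝ) ≤ Real.log (Real.sqrt (G * γ) / γ) / 4 := by rw [hlog]; linarith
  have h := GlobalLevelDInequalityBiglobal_holds n f r γ (Real.sqrt (G * γ)) d hr hγ hγ₂ hbig hd₁' hd₂
  rw [hlog] at h
  convert h using 3
  ring

/-- **The case `G = 1`** (`f : S_n → [−1, 1]`, e.g. `[0,1]`-valued): for `(r, γ, d)`-`L¹`-global `f` with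
`|f| ≤ 1`, `r > 1`, `0 < γ < 1` and `d ≤ min(⅛ log(1/γ), 10⁻⁵ n)`,
`‖f^{=d}‖₂² ≤ γ² (5·10⁵ r² d⁻¹ log(1/γ))^d` — the prover's requested form
"`‖f^{=d}‖₂² ≤ ‖f‖₁² (C r^4 log(1/‖f‖₁)/d)^d`" with `γ = ‖f‖₁`-type `L¹` bounds on all restrictions and
the function normalisation of `r`. [cite: KeevashLifshitz2023, Thm. 3.1 (p. 17)] -/
theorem levelPart_sq_le_of_isL1GlobalSn_unit (f : Equiv.Perm (Fin n) → ℝ) {r γ : ℝ} {d : ℕ}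
    (hr : 1 < r) (hγ : 0 < γ) (hγ1 : γ < 1) (hf1 : ∀ σ, |f σ| ≤ 1) (hglob : IsL1GlobalSn r γ d f)
    (hd₁ : (d : ℝ) ≤ Real.log (1 / γ) / 8) (hd₂ : (d : ℝ) ≤ (n : ℝ) / 10 ^ 5) :
    ‖levelPart n d (vec f)‖ ^ 2 / n.factorial ≤
      γ ^ 2 * (5 * 10 ^ 5 * r ^ 2 * (1 / (d : ℝ)) * Real.log (1 / γ)) ^ d :=
  levelPart_sq_le_of_isL1GlobalSn f hr hγ hγ1 hf1 hglob hd₁ hd₂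

/-- **Consumer ("dual") form**: for `|f| ≤ G`, `(r, γ, d)`-`L¹`-global `f`, `r > 1`, `0 < γ < G`,
`1 ≤ d ≤ min(⅛ log(G/γ), 10⁻⁵ n)` and every test vector `g ∈ V_{≤d}` orthogonal to `V_{≤d−1}`,
`(Σ_σ f σ · g σ)² ≤ ‖g‖² · n! · γ² (5·10⁵ r² d⁻¹ log(G/γ))^d` (`‖g‖² = Σ_σ (g σ)²`).
[cite: KeevashLifshitz2023, Thm. 3.1 (p. 17)] -/
theorem isL1GlobalSn_dual (f : Equiv.Perm (Fin n) → ℝ) {r γ G : ℝ} {d : ℕ} (g : SnSpace n)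
    (hd : 1 ≤ d) (hr : 1 < r) (hγ : 0 < γ) (hγG : γ < G) (hfG : ∀ σ, |f σ| ≤ G)
    (hglob : IsL1GlobalSn r γ d f)
    (hd₁ : (d : ℝ) ≤ Real.log (G / γ) / 8) (hd₂ : (d : ℝ) ≤ (n : ℝ) / 10 ^ 5)
    (hg : g ∈ degLE n d) (hg' : ∀ w ∈ degLE n (d - 1), ⟪g, w⟫_ℝ = 0) :
    (∑ σ, f σ * g σ) ^ 2 ≤
      ‖g‖ ^ 2 * n.factorial * (γ ^ 2 * (5 * 10 ^ 5 * r ^ 2 * (1 / (d : ℝ)) * Real.log (G / γ)) ^ d) := by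
  have hlev := levelPart_sq_le_of_isL1GlobalSn f hr hγ hγG hfG hglob hd₁ hd₂
  have hcs := sq_inner_le_norm_levelPart_sq_mul hd (vec f) hg hg'
  rw [inner_vec_left] at hcs
  have hfac : (0 : ℝ) < n.factorial := by exact_mod_cast n.factorial_pos
  rw [div_le_iff₀ hfac] at hlev
  calc (∑ σ, f σ * g σ) ^ 2 ≤ ‖levelPart n d (vec f)‖ ^ 2 * ‖g‖ ^ 2 := hcs
    _ ≤ (γ ^ 2 * (5 * 10 ^ 5 * r ^ 2 * (1 / (d : ℝ)) * Real.log (G / γ)) ^ d * n.factorial) * ‖g‖ ^ 2 := by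
        gcongr
    _ = _ := by ring

end Literature.Combinatorics.Additive.KeevashLifshitz

end
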